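import Literature.Computability.Complexity.CodeFPBudgets
import HarnessLib

/-!
# Typed polynomial time on codes, IV: integer register programs with clamped loops

Trunk `Computability/Complexity`, continuing `CodeFP.lean` / `CodeFPArith.lean` / `CodeFPBudgets.lean`
(the algebra `CodeFP eα eβ g` of maps computed on codes by `FP` string functions). Assembling a long
arithmetic algorithm (the first client is the infrastructure walk of
`Cryptography/UnitResidueMachine.lean`: some forty registers, three nested loops) combinator by
combinator is unwieldy; this file packages the algebra as a small imperative language whose every
program is typed polynomial time by ONE structural theorem:

* `Ex` — integer expressions over a register file `List ℤ` (registers, constants, `+ - * /`, `|·|`,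
  `⌊√·⌋`, bit size, `2^min(·, N)`, comparisons as `0/1`, conditional), `Ex.eval N regs e`;
* `Prog` — `set i e`, `seq`, `ifp c p` (run `p` when `c ≠ 0`), and `loop p`: run the body EXACTLY
  `N` times, clamping every register to `(-2ᴺ, 2ᴺ)` after each round (`clampAll`), where `N` is a
  unary parameter of the run (fuel = clamp exponent = exponent cap); `Prog.run N P regs`;
* **`Ex.code`, `Prog.code`** — every expression / program is `CodeFP` on `(1ᴺ, regs)`
  (Arora–Barak §1.3: polynomial time is closed under composition and polynomially bounded loops;
  the clamp makes the accumulator bound of `CodeFP.foldl` structural: a clamped register file of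
  fixed length `k` has code length `≤ k(6N + 6)`), together with `length_run` (the register file
  keeps its length) and the unfolding lemmas `run_set`, …, `run_loop` for symbolic execution.

A client proves its algorithm correct on `Prog.run` (showing along the way that its registers stay
below `2ᴺ` at the clamp points, so the clamps are the identity) and gets `FP`-membership for free.

## References

* S. Arora, B. Barak, *Computational Complexity: A Modern Approach*, CUP 2009, §1.3 (closure of
  polynomial time under composition and polynomially bounded loops), §1.4.1 (clocked simulation).
  [AroraBarak2009]
-/

namespace Literature.Computability.Complexity

namespace RegProg

open CodeFP Brick

/-! ### Expressions -/

/-- Integer expressions over a register file (comparisons return `1`/`0`; `ite c a b` is `a` when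
`c ≠ 0`; `pow2 a` is `2 ^ min(a⁺, N)` for the run parameter `N`). [cite: AroraBarak2009, §1.3] -/
inductive Ex : Type
  | reg (i : ℕ)
  | cst (z : ℤ)
  | add (a b : Ex)
  | sub (a b : Ex)
  | mul (a b : Ex)
  | ediv (a b : Ex)
  | abs (a : Ex)
  | sqrt (a : Ex)
  | size (a : Ex)
  | pow2 (a : Ex)
  | lt (a b : Ex)
  | le (a b : Ex)
  | eq (a b : Ex)
  | ite (c a b : Ex)

/-- The value of an expression on the run parameter `N` and the register file. [cite: AroraBarak2009, §1.3] -/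
def Ex.eval (N : ℕ) (l : List ℤ) : Ex → ℤ
  | .reg i => l.getD i 0
  | .cst z => z
  | .add a b => a.eval N l + b.eval N l
  | .sub a b => a.eval N l - b.eval N l
  | .mul a b => a.eval N l * b.eval N l
  | .ediv a b => a.eval N l / b.eval N l
  | .abs a => |a.eval N l|
  | .sqrt a => (Nat.sqrt (a.eval N l).toNat : ℕ)
  | .size a => (Nat.size (a.eval N l).toNat : ℕ)
  | .pow2 a => ((2 : ℕ) ^ min (a.eval N l).toNat N : ℕ)
  | .lt a b => if a.eval N l < b.eval N l then 1 else 0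
  | .le a b => if a.eval N l ≤ b.eval N l then 1 else 0
  | .eq a b => if a.eval N l = b.eval N l then 1 else 0
  | .ite c a b => if c.eval N l = 0 then b.eval N l else a.eval N l

/-- Remainder as a derived expression (`a % b = a - b (a / b)`, Lean's conventions). [folklore] -/
def Ex.emod (a b : Ex) : Ex := .sub a (.mul b (.ediv a b))

/-- The derived remainder evaluates to `%`. [folklore] -/
@[simp] theorem Ex.eval_emod (N : ℕ) (l : List ℤ) (a b : Ex) :
    (Ex.emod a b).eval N l = a.eval N l % b.eval N l := by
  simp only [Ex.emod, Ex.eval]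
  rw [Int.emod_def]

/-- The code of a run: the parameter in unary, the registers as a raw list of integers. [folklore] -/
abbrev stE : ℕ × List ℤ → List Bool := pairE unE (rawE intE)

/-- **Every expression is computed on codes in polynomial time.** [cite: AroraBarak2009, §1.3 (composition)] -/
theorem Ex.code : ∀ e : Ex, CodeFP stE intE (fun p => e.eval p.1 p.2)
  | .reg i => ((rawGetOr intE).comp ((snd unE (rawE intE)).pair
      ((const stE i).pair (const stE (0 : ℤ))))).congr fun p => rfl
  | .cst z => (const stE z).congr fun p => rfl
  | .add a b => (intAdd.comp (a.code.pair b.code)).congr fun p => rfl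
  | .sub a b => (intSub.comp (a.code.pair b.code)).congr fun p => rfl
  | .mul a b => (intMul.comp (a.code.pair b.code)).congr fun p => rfl
  | .ediv a b => (intEDiv.comp (a.code.pair b.code)).congr fun p => rfl
  | .abs a => (intAbs.comp a.code).congr fun p => rfl
  | .sqrt a => (intOfNat.comp (natSqrt.comp (intToNat.comp a.code))).congr fun p => rfl
  | .size a => (intOfNat.comp (strNatLength.comp (strOfNat.comp (intToNat.comp a.code)))).congr
      fun p => by simp only [Ex.eval, length_natE]
  | .pow2 a => (intOfNat.comp (natPow.comp ((const stE (2 : ℕ)).pair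
      (unOfNatMin.comp ((fst unE (rawE intE)).pair (intToNat.comp a.code)))))).congr fun p => rfl
  | .lt a b => ((intLt.comp (a.code.pair b.code)).ite (const stE (1 : ℤ)) (const stE (0 : ℤ))).congr
      fun p => by simp only [Ex.eval]; by_cases h : a.eval p.1 p.2 < b.eval p.1 p.2 <;> simp [h]
  | .le a b => ((intLe.comp (a.code.pair b.code)).ite (const stE (1 : ℤ)) (const stE (0 : ℤ))).congr
      fun p => by simp only [Ex.eval]; by_cases h : a.eval p.1 p.2 ≤ b.eval p.1 p.2 <;> simp [h]
  | .eq a b => ((intEq.comp (a.code.pair b.code)).ite (const stE (1 : ℤ)) (const stE (0 : ℤ))).congr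
      fun p => by simp only [Ex.eval]; by_cases h : a.eval p.1 p.2 = b.eval p.1 p.2 <;> simp [h]
  | .ite c a b => ((intEq.comp (c.code.pair (const stE (0 : ℤ)))).ite b.code a.code).congr
      fun p => by simp only [Ex.eval]; by_cases h : c.eval p.1 p.2 = 0 <;> simp [h]

/-! ### Programs -/

/-- Register programs: assignment, sequence, guarded block, clamped loop. [cite: AroraBarak2009, §1.3] -/
inductive Prog : Type
  | set (i : ℕ) (e : Ex)
  | seq (p q : Prog)
  | ifp (c : Ex) (p : Prog)
  | loop (p : Prog)

/-- Clamp an integer to `(-2ᴺ, 2ᴺ)` (else `0`). [folklore] -/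
def clampZ (N : ℕ) (z : ℤ) : ℤ := if z.natAbs < 2 ^ N then z else 0

/-- Clamp every register. [folklore] -/
def clampAll (N : ℕ) (l : List ℤ) : List ℤ := l.map (clampZ N)

/-- **Semantics**: `set` writes a register (no-op past the end), `ifp c p` runs `p` when `c ≠ 0`,
`loop p` runs `clampAll ∘ p` exactly `N` times. [cite: AroraBarak2009, §1.3 (bounded loops), §1.4.1] -/
def Prog.run (N : ℕ) : Prog → List ℤ → List ℤ
  | .set i e, l => l.set i (e.eval N l)
  | .seq p q, l => q.run N (p.run N l)
  | .ifp c p, l => if c.eval N l = 0 then l else p.run N l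
  | .loop p, l => (fun l => clampAll N (p.run N l))^[N] l

/-- Unfolding `run` on an assignment. [folklore] -/
@[simp] theorem run_set (N : ℕ) (i : ℕ) (e : Ex) (l : List ℤ) :
    (Prog.set i e).run N l = l.set i (e.eval N l) := rfl
/-- Unfolding `run` on a sequence. [folklore] -/
@[simp] theorem run_seq (N : ℕ) (p q : Prog) (l : List ℤ) : (Prog.seq p q).run N l = q.run N (p.run N l) := rfl
/-- Unfolding `run` on a guarded block. [folklore] -/
@[simp] theorem run_ifp (N : ℕ) (c : Ex) (p : Prog) (l : List ℤ) :
    (Prog.ifp c p).run N l = if c.eval N l = 0 then l else p.run N l := rfl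
/-- Unfolding `run` on a clamped loop. [folklore] -/
@[simp] theorem run_loop (N : ℕ) (p : Prog) (l : List ℤ) :
    (Prog.loop p).run N l = (fun l => clampAll N (p.run N l))^[N] l := rfl

/-- A clamp below its threshold is the identity. [folklore] -/
theorem clampZ_of_lt {N : ℕ} {z : ℤ} (h : z.natAbs < 2 ^ N) : clampZ N z = z := if_pos h

/-- Clamping a register file all of whose entries are small is the identity. [folklore] -/
theorem clampAll_of_forall {N : ℕ} {l : List ℤ} (h : ∀ z ∈ l, z.natAbs < 2 ^ N) : clampAll N l = l := by
  unfold clampAll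
  conv_rhs => rw [← List.map_id l]
  exact List.map_congr_left fun z hz => clampZ_of_lt (h z hz)

/-- Clamping keeps the length. [folklore] -/
@[simp] theorem length_clampAll (N : ℕ) (l : List ℤ) : (clampAll N l).length = l.length := List.length_map _

/-- **Programs keep the length of the register file.** [folklore] -/
theorem length_run (N : ℕ) : ∀ (P : Prog) (l : List ℤ), (P.run N l).length = l.length
  | .set i e, l => by simp
  | .seq p q, l => by rw [run_seq, length_run N q, length_run N p]
  | .ifp c p, l => by rw [run_ifp]; split_ifs <;> simp [length_run N p]
  | .loop p, l => by
    have key : ∀ (k : ℕ) (l : List ℤ), ((fun l => clampAll N (p.run N l))^[k] l).length = l.length := by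
      intro k
      induction k with
      | zero => intro l; rfl
      | succ k ih => intro l; rw [Function.iterate_succ_apply', length_clampAll, length_run N p, ih]
    exact key N l

/-- Folding clamped rounds keeps the length. [folklore] -/
theorem length_foldl_rounds (N : ℕ) (p : Prog) (u : List Unit) (l : List ℤ) :
    (u.foldl (fun b _ => clampAll N (p.run N b)) l).length = l.length := by
  induction u generalizing l with
  | nil => rfl
  | cons _ u ih => rw [List.foldl_cons, ih, length_clampAll, length_run]

/-- Iterating along a list of units is a `foldl`. [folklore] -/
theorem foldl_units_eq_iterate {β : Type} (F : β → β) (n : ℕ) (s₀ : β) :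
    (List.replicate n ()).foldl (fun s _ => F s) s₀ = F^[n] s₀ := by
  induction n generalizing s₀ with
  | zero => rfl
  | succ n ih => rw [List.replicate_succ, List.foldl_cons, ih, Function.iterate_succ_apply]

/-! ### Sizes of clamped register files -/

/-- A clamped integer has a short code: `|intE (clampZ N z)| ≤ 3N + 2`. [folklore] -/
theorem length_intE_clampZ (N : ℕ) (z : ℤ) : (intE (clampZ N z)).length ≤ 3 * N + 2 := by
  unfold clampZ
  split_ifs with h
  · have h1 := length_dpEnc_le z
    have h2 : Nat.size z.natAbs ≤ N := Nat.size_le.mpr h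
    change (dpEnc z).length ≤ _
    omega
  · have h1 := length_dpEnc_le 0
    change (dpEnc 0).length ≤ _
    simp at h1
    omega

/-- **A clamped register file of length `k` has code length `≤ k(6N + 6)`.** [folklore] -/
theorem length_rawE_clampAll (N : ℕ) (L : List ℤ) :
    (rawE intE (clampAll N L)).length ≤ L.length * (6 * N + 6) := by
  rw [length_rawE]
  unfold clampAll
  rw [List.map_map]
  calc ((L.map ((fun a => 2 * (intE a).length + 2) ∘ clampZ N))).sum
      ≤ (L.map ((fun a => 2 * (intE a).length + 2) ∘ clampZ N)).length • (6 * N + 6) :=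
        List.sum_le_card_nsmul _ _ fun x hx => by
          obtain ⟨z, _, rfl⟩ := List.mem_map.1 hx
          have := length_intE_clampZ N z
          simp only [Function.comp_apply]
          omega
    _ = L.length * (6 * N + 6) := by rw [List.length_map, smul_eq_mul]

/-! ### Programs are typed polynomial time -/

/-- Writing a register, on codes (`take ++ v :: drop` under the length test). [cite: AroraBarak2009, §1.3] -/
theorem setCode (i : ℕ) (e : Ex) : CodeFP stE (rawE intE) (fun p => p.2.set i (e.eval p.1 p.2)) := by
  have hl : CodeFP stE (rawE intE) (fun p => p.2) := snd _ _
  have hv : CodeFP stE intE (fun p => e.eval p.1 p.2) := e.code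
  have htest : CodeFP stE bitE (fun p => decide (i < p.2.length)) :=
    natLt.comp ((const stE i).pair ((natLength intE).comp hl))
  have hnew : CodeFP stE (rawE intE) (fun p => p.2.take i ++ e.eval p.1 p.2 :: p.2.drop (i + 1)) :=
    (rawAppend intE).comp (((rawTakeUn intE).comp ((const stE i).pair hl)).pair
      ((rawCons intE).comp (hv.pair ((rawDropUn intE).comp ((const stE (i + 1)).pair hl)))))
  refine (htest.ite hnew hl).congr fun p => ?_
  rw [List.set_eq_take_append_cons_drop]
  by_cases h : i < p.2.length <;> simp [h]

/-- The clamp on codes. [folklore] -/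
theorem clampZCode : CodeFP (pairE unE intE) intE (fun p => clampZ p.1 p.2) := by
  have hz : CodeFP (pairE unE intE) intE (fun p => p.2) := snd _ _
  have h2N : CodeFP (pairE unE intE) natE (fun p => 2 ^ p.1) := natPow.comp ((const _ (2 : ℕ)).pair (fst _ _))
  have htest : CodeFP (pairE unE intE) bitE (fun p => decide (p.2.natAbs < 2 ^ p.1)) :=
    natLt.comp ((intNatAbs.comp hz).pair h2N)
  exact (htest.ite hz (const _ (0 : ℤ))).congr fun p => by
    unfold clampZ
    by_cases h : p.2.natAbs < 2 ^ p.1 <;> simp [h]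

/-- The clamp of the register file on codes. [folklore] -/
theorem clampAllCode : CodeFP stE (rawE intE) (fun p => clampAll p.1 p.2) :=
  (map clampZCode).congr fun _ => rfl

/-- **Every register program is computed on codes in polynomial time** (composition, branching, and
`CodeFP.foldl` for the loop with the structural bound `k(6N + 6)` on a clamped register file).
[cite: AroraBarak2009, §1.3 (closure under composition and polynomially bounded loops)] -/
theorem Prog.code : ∀ P : Prog, CodeFP stE (rawE intE) (fun p => P.run p.1 p.2)
  | .set i e => (setCode i e).congr fun p => rfl
  | .seq p q => (q.code.comp ((fst _ _).pair p.code)).congr fun t => rfl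
  | .ifp c p => (((intEq.comp (c.code.pair (const stE (0 : ℤ)))).ite (snd _ _) p.code).congr fun t => by
      simp only [Prog.run]
      by_cases h : c.eval t.1 t.2 = 0 <;> simp [h])
  | .loop p => by
    have hstep : CodeFP (pairE stE (pairE unitE (rawE intE))) (rawE intE)
        (fun t => clampAll t.1.1 (p.run t.1.1 t.2.2)) :=
      clampAllCode.comp ((fst _ _).fst'.pair (p.code.comp ((fst _ _).fst'.pair (snd _ _).snd')))
    have hinit : CodeFP stE (rawE intE) (fun s => s.2) := snd _ _
    have h := foldl (σ := ℕ × List ℤ) (α := Unit) (β := List ℤ) (eσ := stE) (eα := unitE)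
      (eβ := rawE intE) (step := fun s _ acc => clampAll s.1 (p.run s.1 acc)) (init := fun s => s.2)
      hstep hinit (Polynomial.X * (6 * Polynomial.X + 8)) (fun s l₁ l₂ => by
        obtain ⟨N, regs⟩ := s
        set W := (pairE stE (rawE unitE) ((N, regs), l₁ ++ l₂)).length with hW
        have hrl := length_le_length_rawE intE regs
        have hN : N ≤ W ∧ (rawE intE regs).length ≤ W ∧ regs.length ≤ W := by
          simp only [hW, pairE_apply, length_boolPair, length_unE, stE]
          omega
        rw [Polynomial.eval_mul, Polynomial.eval_add, Polynomial.eval_mul, Polynomial.eval_X,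
          Polynomial.eval_ofNat, Polynomial.eval_ofNat]
        rcases List.eq_nil_or_concat l₁ with h0 | ⟨l₁', u, h0⟩
        · subst h0
          simp only [List.foldl_nil]
          nlinarith
        · subst h0
          rw [List.concat_eq_append, List.foldl_append, List.foldl_cons, List.foldl_nil]
          refine (length_rawE_clampAll N _).trans ?_
          rw [length_run, length_foldl_rounds]
          exact Nat.mul_le_mul hN.2.2 (by omega))
    refine ((h.comp ((CodeFP.id stE).pair (replicateUnit.comp (fst _ _)))).congr fun t => ?_)
    exact foldl_units_eq_iterate _ t.1 t.2

end RegProg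

end Literature.Computability.Complexity
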